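import Literature.Combinatorics.Sahi2008.Percolation
import Literature.Probability.LatticeModels.ProdBernoulliIndependence
import HarnessLib

/-!
# The increasing star is a BLOCK property: series composition lemmas for `E₃`

Support file for the Sahi programme (`--supports stmt-CriticalPhenomena-4575`, prover prim-sahi-p2 gen 8).
No definitions, no named facts, no sorries; standard axioms.  Memo `…/prim-sahi-p2/PROOF-E3.md` §19(f).

If a target `t` hangs off the root's block `B` behind an articulation vertex `a`, then
`{s ↔ t} = {s ↔_B a} ∩ {a ↔_{G_a} t}`, the second factor being an event of the branch `G_a`, independent of
everything in `B`.  The increasing star `E₃({s↔t₁},{s↔t₂},{s↔t₃}) ≥ 0` then reduces to the blocks through three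
elementary identities for Sahi's `E₃ = 2E(fgh) + E(f)E(g)E(h) − Σ E(f)E(gh)`, proved here for an arbitrary
finite weight in the abstract "moment" form (the hypotheses are the factorised moments) and, for product
Bernoulli measures, in event form (events determined by disjoint coordinate sets):

* `sahiE_three_scale_of_moments` — ONE slot carries an independent scalar factor:
  `E₃(h·f, g₂, g₃) = E(h)·E₃(f, g₂, g₃)`;
* `sahiE_three_nonneg_of_commonFactor_three` — THREE slots behind the same articulation point,
  `E₃(f h₁, f h₂, f h₃) = λ(2u₁₂₃ − λ Σ uᵢu_{jk} + λ² u₁u₂u₃) ≥ 0` (`λ = E f`, `u_S` the moments of the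
  independent family `h`), given `E₃(h) ≥ 0` and pairwise positive correlation of the `hᵢ`;
* `sahiE_three_nonneg_of_commonFactor_two` — TWO slots behind the same articulation point and a third
  event `g` on the block side: `E₃(f h₁, f h₂, g) = (2E(fg) − E(f)E(g))·(u₁₂ − E(f)u₁u₂) ≥ 0`, given
  `E(fg) ≥ E(f)E(g)` and `u₁₂ ≥ u₁u₂`;
* event forms `sahiE3_inter_scale`, `sahiE3_commonFactor_three_nonneg`, `sahiE3_commonFactor_two_nonneg` for
  `prodBernoulli p`, with the independence supplied by `prodBernoulli_real_inter_of_determinedBy`.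

Consequence (memo §19(f), paper-level): the class of rooted weighted graphs on which
`E₃({s↔t₁},{s↔t₂},{s↔t₃}) ≥ 0` for all targets is closed under gluing at the root and under hanging a member
at any vertex of another; with `…IncStarCycle.lean` every CACTUS graph (all blocks cycles or edges) carries
the increasing star, and a minimal counterexample to the increasing star is 2-connected.
-/

noncomputable section

namespace Summit.CriticalPhenomena.PercolationContinuityZ3.Theorems

namespace IncStarBlocks

open Finset MeasureTheory Literature.Combinatorics.Sahi2008 Literature.Probability.Percolation
  Literature.Probability.LatticeModels
open Literature.Probability.Percolation.DecisionTree (ind ind_of_mem ind_of_not_mem ind_nonneg)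
open scoped Classical

/-! ### Abstract moment forms (any finite weight) -/

section Moments

variable {α : Type*} [Fintype α] (μ : α → ℝ)

/-- **An independent scalar factor in one slot**: if the moments of `φ` against the other two slots are `c` times
those of `f`, then `E₃(φ, g₂, g₃) = c·E₃(f, g₂, g₃)`. [this work] -/
theorem sahiE_three_scale_of_moments {c : ℝ} {φ f g₂ g₃ : α → ℝ} (h1 : ex μ φ = c * ex μ f)
    (h2 : ex μ (φ * g₂) = c * ex μ (f * g₂)) (h3 : ex μ (φ * g₃) = c * ex μ (f * g₃))
    (h4 : ex μ (φ * g₂ * g₃) = c * ex μ (f * g₂ * g₃)) :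
    sahiE μ 3 ![φ, g₂, g₃] = c * sahiE μ 3 ![f, g₂, g₃] := by
  rw [sahiE_three, sahiE_three]
  have h2' : ex μ (g₂ * φ) = c * ex μ (g₂ * f) := by rw [mul_comm g₂ φ, mul_comm g₂ f, h2]
  have h3' : ex μ (g₃ * φ) = c * ex μ (g₃ * f) := by rw [mul_comm g₃ φ, mul_comm g₃ f, h3]
  rw [h1, h4, mul_comm g₂ (φ), mul_comm g₃ φ] at *
  rw [show φ * g₃ = g₃ * φ from mul_comm _ _, show φ * g₂ = g₂ * φ from mul_comm _ _] at *
  rw [show f * g₃ = g₃ * f from mul_comm _ _, show f * g₂ = g₂ * f from mul_comm _ _] at *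
  rw [h2', h3']
  ring

/-- **Three slots behind a common factor.**  If the moments of `(φ₁, φ₂, φ₃)` are `lam·u_S` (`lam ∈ [0,1]`, e.g.
`φᵢ = f·hᵢ` with `f` a `0/1` function independent of `h`, `lam = E f`, `u_S = E(Π_S h)`), the `uᵢ` are
nonnegative and pairwise super-multiplicative (`uᵢuⱼ ≤ u_{ij}`) and `E₃` of the `u`-moments is nonnegative, then
`E₃(φ₁, φ₂, φ₃) ≥ 0`; indeed `E₃(φ) = lam·(2u₁₂₃ − lam·Σuᵢu_{jk} + lam²·u₁u₂u₃)` and the bracket decreases in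
`lam` down to `E₃(u) ≥ 0` at `lam = 1`. [this work] -/
theorem sahiE_three_nonneg_of_commonFactor_three {φ₁ φ₂ φ₃ : α → ℝ}
    {lam u₁ u₂ u₃ u₁₂ u₁₃ u₂₃ u₁₂₃ : ℝ}
    (h1 : ex μ φ₁ = lam * u₁) (h2 : ex μ φ₂ = lam * u₂) (h3 : ex μ φ₃ = lam * u₃)
    (h12 : ex μ (φ₁ * φ₂) = lam * u₁₂) (h13 : ex μ (φ₁ * φ₃) = lam * u₁₃) (h23 : ex μ (φ₂ * φ₃) = lam * u₂₃)
    (h123 : ex μ (φ₁ * φ₂ * φ₃) = lam * u₁₂₃)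
    (hlam0 : 0 ≤ lam) (hlam1 : lam ≤ 1) (hu₁ : 0 ≤ u₁) (hu₂ : 0 ≤ u₂) (hu₃ : 0 ≤ u₃)
    (hc12 : u₁ * u₂ ≤ u₁₂) (hc13 : u₁ * u₃ ≤ u₁₃) (hc23 : u₂ * u₃ ≤ u₂₃)
    (hE : 0 ≤ 2 * u₁₂₃ + u₁ * u₂ * u₃ - (u₁ * u₂₃ + u₂ * u₁₃ + u₃ * u₁₂)) :
    0 ≤ sahiE μ 3 ![φ₁, φ₂, φ₃] := by
  rw [sahiE_three, h1, h2, h3, h123]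
  rw [show φ₂ * φ₃ = φ₂ * φ₃ from rfl, h23, h13, h12]
  -- value = lam * (2 u₁₂₃ − lam A + lam² B)
  set A := u₁ * u₂₃ + u₂ * u₁₃ + u₃ * u₁₂ with hA
  set B := u₁ * u₂ * u₃ with hB
  have hAB : 3 * B ≤ A := by
    rw [hA, hB]
    nlinarith [mul_le_mul_of_nonneg_left hc23 hu₁, mul_le_mul_of_nonneg_left hc13 hu₂,
      mul_le_mul_of_nonneg_left hc12 hu₃]
  have hB0 : 0 ≤ B := by rw [hB]; positivity
  have hval : 2 * (lam * u₁₂₃) + lam * u₁ * (lam * u₂) * (lam * u₃) -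
      (lam * u₁ * (lam * u₂₃) + lam * u₂ * (lam * u₁₃) + lam * u₃ * (lam * u₁₂)) =
      lam * (2 * u₁₂₃ - lam * A + lam ^ 2 * B) := by rw [hA, hB]; ring
  rw [hval]
  refine mul_nonneg hlam0 ?_
  -- the bracket at `lam` is ≥ the bracket at `1`, which is `E₃(u) ≥ 0`
  have hmono : 2 * u₁₂₃ - A + B ≤ 2 * u₁₂₃ - lam * A + lam ^ 2 * B := by
    have : (1 - lam) * (A - (1 + lam) * B) ≥ 0 := by
      refine mul_nonneg (by linarith) ?_
      nlinarith
    nlinarith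
  have hE' : 0 ≤ 2 * u₁₂₃ - A + B := by rw [hA, hB]; linarith
  linarith

/-- **Two slots behind a common factor, third slot on the block side.**  If
`E φ₁ = F u₁`, `E φ₂ = F u₂`, `E(φ₁φ₂) = F u₁₂`, `E g = γ`, `E(φ₁ g) = Q u₁`, `E(φ₂ g) = Q u₂`, `E(φ₁φ₂g) = Q u₁₂`
(e.g. `φᵢ = f hᵢ`, `h ⊥ (f, g)`, `F = E f`, `Q = E(fg)`), with `0 ≤ F ≤ 1`, `0 ≤ γ`, `F γ ≤ Q`, `uᵢ ≥ 0`,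
`u₁u₂ ≤ u₁₂`, then `E₃(φ₁, φ₂, g) = (2Q − Fγ)(u₁₂ − F u₁u₂) ≥ 0`. [this work] -/
theorem sahiE_three_nonneg_of_commonFactor_two {φ₁ φ₂ g : α → ℝ} {F u₁ u₂ u₁₂ γ Q : ℝ}
    (h1 : ex μ φ₁ = F * u₁) (h2 : ex μ φ₂ = F * u₂) (h12 : ex μ (φ₁ * φ₂) = F * u₁₂) (hg : ex μ g = γ)
    (h1g : ex μ (φ₁ * g) = Q * u₁) (h2g : ex μ (φ₂ * g) = Q * u₂) (h12g : ex μ (φ₁ * φ₂ * g) = Q * u₁₂)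
    (hF0 : 0 ≤ F) (hF1 : F ≤ 1) (hγ : 0 ≤ γ) (hQ : F * γ ≤ Q) (hu₁ : 0 ≤ u₁) (hu₂ : 0 ≤ u₂)
    (hc : u₁ * u₂ ≤ u₁₂) :
    0 ≤ sahiE μ 3 ![φ₁, φ₂, g] := by
  rw [sahiE_three, h1, h2, hg, h12g, h2g, h1g, h12]
  have hval : 2 * (Q * u₁₂) + F * u₁ * (F * u₂) * γ - (F * u₁ * (Q * u₂) + F * u₂ * (Q * u₁) + γ * (F * u₁₂)) =
      (2 * Q - F * γ) * (u₁₂ - F * (u₁ * u₂)) := by ring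
  rw [hval]
  refine mul_nonneg (by nlinarith) ?_
  have : F * (u₁ * u₂) ≤ u₁ * u₂ := by nlinarith [mul_nonneg hu₁ hu₂]
  linarith

end Moments

/-! ### Event forms for product Bernoulli measures -/

section Events

variable {ι : Type*} [Fintype ι] (p : ι → unitInterval)

/-- `E[1_A] = P(A)` and products of indicators are indicators of intersections (plumbing). [folklore] -/
private theorem ex_ind_inter (A B : Set (Set ι)) :
    ex (bernoulliWeight p) (ind A * ind B) = (prodBernoulli p).real (A ∩ B) := by
  rw [← ex_bernoulliWeight_ind]
  congr 1
  funext ω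
  exact (BHK2006.ind_inter A B ω).symm

/-- `E[1_A 1_B 1_C] = P(A ∩ B ∩ C)` (plumbing). [folklore] -/
private theorem ex_ind_inter₃ (A B C : Set (Set ι)) :
    ex (bernoulliWeight p) (ind A * ind B * ind C) = (prodBernoulli p).real (A ∩ B ∩ C) := by
  rw [← ex_bernoulliWeight_ind]
  congr 1
  funext ω
  rw [Pi.mul_apply, Pi.mul_apply, BHK2006.ind_inter, BHK2006.ind_inter]

/-- **A pendant branch behind one target scales `E₃`**: if `B` is determined by `F` and `D, G₂, G₃` by `Fᶜ`, then
`E₃(D ∩ B, G₂, G₃) = P(B)·E₃(D, G₂, G₃)` under `prodBernoulli p`. [this work] -/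
theorem sahiE3_inter_scale (F : Finset ι) {B D G₂ G₃ : Set (Set ι)} (hB : DeterminedBy B (↑F : Set ι))
    (hD : DeterminedBy D (↑F : Set ι)ᶜ) (hG₂ : DeterminedBy G₂ (↑F : Set ι)ᶜ) (hG₃ : DeterminedBy G₃ (↑F : Set ι)ᶜ)
    (hBm : MeasurableSet B) (hDm : MeasurableSet D) (hG₂m : MeasurableSet G₂) (hG₃m : MeasurableSet G₃) :
    sahiE3 (prodBernoulli p) (D ∩ B) G₂ G₃ = (prodBernoulli p).real B * sahiE3 (prodBernoulli p) D G₂ G₃ := by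
  rw [← sahiE_three_ind, ← sahiE_three_ind]
  have key : ∀ {X : Set (Set ι)}, DeterminedBy X (↑F : Set ι)ᶜ → MeasurableSet X →
      (prodBernoulli p).real (B ∩ X) = (prodBernoulli p).real B * (prodBernoulli p).real X :=
    fun hX hXm => prodBernoulli_real_inter_of_determinedBy p F hB hX hBm hXm
  refine sahiE_three_scale_of_moments (bernoulliWeight p) (c := (prodBernoulli p).real B) ?_ ?_ ?_ ?_
  · rw [ex_bernoulliWeight_ind, ex_bernoulliWeight_ind, Set.inter_comm, key hD hDm]
  · rw [ex_ind_inter, ex_ind_inter, show D ∩ B ∩ G₂ = B ∩ (D ∩ G₂) by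
        rw [Set.inter_comm D B, Set.inter_assoc],
      key (DeterminedBy.inter hD hG₂) (hDm.inter hG₂m)]
  · rw [ex_ind_inter, ex_ind_inter, show D ∩ B ∩ G₃ = B ∩ (D ∩ G₃) by
        rw [Set.inter_comm D B, Set.inter_assoc],
      key (DeterminedBy.inter hD hG₃) (hDm.inter hG₃m)]
  · rw [ex_ind_inter₃, ex_ind_inter₃, show D ∩ B ∩ G₂ ∩ G₃ = B ∩ (D ∩ G₂ ∩ G₃) by
        rw [Set.inter_comm D B, Set.inter_assoc, Set.inter_assoc, Set.inter_assoc],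
      key (DeterminedBy.inter (DeterminedBy.inter hD hG₂) hG₃) ((hDm.inter hG₂m).inter hG₃m)]

/-- **Three targets behind one articulation point (event form).**  `D` determined by `F` (the near side),
`H₁, H₂, H₃` determined by `Fᶜ` (the branch), the `Hᵢ` pairwise positively correlated and
`E₃(H₁, H₂, H₃) ≥ 0`; then `E₃(D ∩ H₁, D ∩ H₂, D ∩ H₃) ≥ 0` under `prodBernoulli p`. [this work] -/
theorem sahiE3_commonFactor_three_nonneg (F : Finset ι) {D H₁ H₂ H₃ : Set (Set ι)}
    (hD : DeterminedBy D (↑F : Set ι)) (hH₁ : DeterminedBy H₁ (↑F : Set ι)ᶜ)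
    (hH₂ : DeterminedBy H₂ (↑F : Set ι)ᶜ) (hH₃ : DeterminedBy H₃ (↑F : Set ι)ᶜ)
    (hDm : MeasurableSet D) (hH₁m : MeasurableSet H₁) (hH₂m : MeasurableSet H₂) (hH₃m : MeasurableSet H₃)
    (hc12 : (prodBernoulli p).real H₁ * (prodBernoulli p).real H₂ ≤ (prodBernoulli p).real (H₁ ∩ H₂))
    (hc13 : (prodBernoulli p).real H₁ * (prodBernoulli p).real H₃ ≤ (prodBernoulli p).real (H₁ ∩ H₃))
    (hc23 : (prodBernoulli p).real H₂ * (prodBernoulli p).real H₃ ≤ (prodBernoulli p).real (H₂ ∩ H₃))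
    (hE : 0 ≤ sahiE3 (prodBernoulli p) H₁ H₂ H₃) :
    0 ≤ sahiE3 (prodBernoulli p) (D ∩ H₁) (D ∩ H₂) (D ∩ H₃) := by
  have key : ∀ {X : Set (Set ι)}, DeterminedBy X (↑F : Set ι)ᶜ → MeasurableSet X →
      (prodBernoulli p).real (D ∩ X) = (prodBernoulli p).real D * (prodBernoulli p).real X :=
    fun hX hXm => prodBernoulli_real_inter_of_determinedBy p F hD hX hDm hXm
  rw [← sahiE_three_ind]
  rw [sahiE3_def] at hE
  refine sahiE_three_nonneg_of_commonFactor_three (bernoulliWeight p)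
    (lam := (prodBernoulli p).real D) (u₁ := (prodBernoulli p).real H₁) (u₂ := (prodBernoulli p).real H₂)
    (u₃ := (prodBernoulli p).real H₃) (u₁₂ := (prodBernoulli p).real (H₁ ∩ H₂))
    (u₁₃ := (prodBernoulli p).real (H₁ ∩ H₃)) (u₂₃ := (prodBernoulli p).real (H₂ ∩ H₃))
    (u₁₂₃ := (prodBernoulli p).real (H₁ ∩ H₂ ∩ H₃)) ?_ ?_ ?_ ?_ ?_ ?_ ?_
    measureReal_nonneg measureReal_le_one measureReal_nonneg measureReal_nonneg measureReal_nonneg hc12 hc13 hc23 ?_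
  · rw [ex_bernoulliWeight_ind, key hH₁ hH₁m]
  · rw [ex_bernoulliWeight_ind, key hH₂ hH₂m]
  · rw [ex_bernoulliWeight_ind, key hH₃ hH₃m]
  · rw [ex_ind_inter, show D ∩ H₁ ∩ (D ∩ H₂) = D ∩ (H₁ ∩ H₂) by ext ω; simp only [Set.mem_inter_iff]; tauto,
      key (DeterminedBy.inter hH₁ hH₂) (hH₁m.inter hH₂m)]
  · rw [ex_ind_inter, show D ∩ H₁ ∩ (D ∩ H₃) = D ∩ (H₁ ∩ H₃) by ext ω; simp only [Set.mem_inter_iff]; tauto,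
      key (DeterminedBy.inter hH₁ hH₃) (hH₁m.inter hH₃m)]
  · rw [ex_ind_inter, show D ∩ H₂ ∩ (D ∩ H₃) = D ∩ (H₂ ∩ H₃) by ext ω; simp only [Set.mem_inter_iff]; tauto,
      key (DeterminedBy.inter hH₂ hH₃) (hH₂m.inter hH₃m)]
  · rw [ex_ind_inter₃, show D ∩ H₁ ∩ (D ∩ H₂) ∩ (D ∩ H₃) = D ∩ (H₁ ∩ H₂ ∩ H₃) by
        ext ω; simp only [Set.mem_inter_iff]; tauto,
      key (DeterminedBy.inter (DeterminedBy.inter hH₁ hH₂) hH₃) ((hH₁m.inter hH₂m).inter hH₃m)]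
  · linarith

/-- **Two targets behind one articulation point, one on the near side (event form).**  `D, G` determined by `F`,
`H₁, H₂` by `Fᶜ`, `P(H₁ ∩ H₂) ≥ P(H₁)P(H₂)` and `P(D ∩ G) ≥ P(D)P(G)`; then `E₃(D ∩ H₁, D ∩ H₂, G) ≥ 0` under
`prodBernoulli p`. [this work] -/
theorem sahiE3_commonFactor_two_nonneg (F : Finset ι) {D G H₁ H₂ : Set (Set ι)}
    (hD : DeterminedBy D (↑F : Set ι)) (hG : DeterminedBy G (↑F : Set ι))
    (hH₁ : DeterminedBy H₁ (↑F : Set ι)ᶜ) (hH₂ : DeterminedBy H₂ (↑F : Set ι)ᶜ)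
    (hDm : MeasurableSet D) (hGm : MeasurableSet G) (hH₁m : MeasurableSet H₁) (hH₂m : MeasurableSet H₂)
    (hc12 : (prodBernoulli p).real H₁ * (prodBernoulli p).real H₂ ≤ (prodBernoulli p).real (H₁ ∩ H₂))
    (hDG : (prodBernoulli p).real D * (prodBernoulli p).real G ≤ (prodBernoulli p).real (D ∩ G)) :
    0 ≤ sahiE3 (prodBernoulli p) (D ∩ H₁) (D ∩ H₂) G := by
  have key : ∀ {Y X : Set (Set ι)}, DeterminedBy Y (↑F : Set ι) → MeasurableSet Y →
      DeterminedBy X (↑F : Set ι)ᶜ → MeasurableSet X →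
      (prodBernoulli p).real (Y ∩ X) = (prodBernoulli p).real Y * (prodBernoulli p).real X :=
    fun hY hYm hX hXm => prodBernoulli_real_inter_of_determinedBy p F hY hX hYm hXm
  rw [← sahiE_three_ind]
  refine sahiE_three_nonneg_of_commonFactor_two (bernoulliWeight p)
    (F := (prodBernoulli p).real D) (u₁ := (prodBernoulli p).real H₁) (u₂ := (prodBernoulli p).real H₂)
    (u₁₂ := (prodBernoulli p).real (H₁ ∩ H₂)) (γ := (prodBernoulli p).real G)
    (Q := (prodBernoulli p).real (D ∩ G)) ?_ ?_ ?_ ?_ ?_ ?_ ?_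
    measureReal_nonneg measureReal_le_one measureReal_nonneg hDG measureReal_nonneg measureReal_nonneg hc12
  · rw [ex_bernoulliWeight_ind, key hD hDm hH₁ hH₁m]
  · rw [ex_bernoulliWeight_ind, key hD hDm hH₂ hH₂m]
  · rw [ex_ind_inter, show D ∩ H₁ ∩ (D ∩ H₂) = D ∩ (H₁ ∩ H₂) by ext ω; simp only [Set.mem_inter_iff]; tauto,
      key hD hDm (DeterminedBy.inter hH₁ hH₂) (hH₁m.inter hH₂m)]
  · rw [ex_bernoulliWeight_ind]
  · rw [ex_ind_inter, show D ∩ H₁ ∩ G = (D ∩ G) ∩ H₁ by ext ω; simp only [Set.mem_inter_iff]; tauto,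
      key (DeterminedBy.inter hD hG) (hDm.inter hGm) hH₁ hH₁m]
  · rw [ex_ind_inter, show D ∩ H₂ ∩ G = (D ∩ G) ∩ H₂ by ext ω; simp only [Set.mem_inter_iff]; tauto,
      key (DeterminedBy.inter hD hG) (hDm.inter hGm) hH₂ hH₂m]
  · rw [ex_ind_inter₃, show D ∩ H₁ ∩ (D ∩ H₂) ∩ G = (D ∩ G) ∩ (H₁ ∩ H₂) by
        ext ω; simp only [Set.mem_inter_iff]; tauto,
      key (DeterminedBy.inter hD hG) (hDm.inter hGm) (DeterminedBy.inter hH₁ hH₂) (hH₁m.inter hH₂m)]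

end Events

end IncStarBlocks

end Summit.CriticalPhenomena.PercolationContinuityZ3.Theorems
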